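import Mathlib
import Summits.Ventures.PercRepro2.Defs
import Summits.Ventures.PercRepro2.Graph
import Summits.Ventures.PercRepro2.OneColourSwitch
import Summits.Ventures.PercRepro2.RegionHubSign
import Summits.Ventures.PercRepro2.SideSwitch
import Summits.Ventures.PercRepro2.SideSwitchFibre
import Summits.Ventures.PercRepro2.SideSwitchComps
import Summits.Ventures.PercRepro2.TermSwitchDefs
import Summits.Ventures.PercRepro2.TermSwitchFibre
import Summits.Ventures.PercRepro2.TermSwitchMono
import Summits.Ventures.PercRepro2.TermSwitchM9
import Summits.Ventures.PercRepro2.TermSwitchRestrict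
import Summits.Ventures.PercRepro2.M9NoPocketDefs
import Summits.Ventures.PercRepro2.M9PocketRepAB

/-!
# The one-sided `K`-part is non-positive on every `d`-star co-fibre (blind cell PercRepro2,
p3 g33, 2026-08-28; `proofs/P3-BSTAR.md` §3)

Fix the colours `c` of the edges at a non-mark `d`.  The `K`-only colourings with that star,
`kOnlyStarSum = Σ_{Sep ∧ DOne ∧ d ∈ K₂ ∖ M₂, ω|star = c} σ_pq σ_rs`, are `Sep ∧ DZero`
colourings of the pair `{r, s}`, and in the `DZero` fibration of `TermSwitchRestrict` (terminal
set `H = {r, s}`) they fill exactly the HALF `{d's block on the Y-side}` of every fibre whose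
representative has the star `c` at `d` — the star of `d` is constant on that half and flipped on
the other half (`starEq_assignC_of_notMem_unionT`, `starEq_assignC_of_mem_unionT`: an edge at `d`
touches the switched set iff `d` does, because the components are closed under adjacency inside
the sided set).  So the predicate «`K`-only with star `c`, or `M`-only with star `¬c`» is
fibre-invariant and invariant under the outside flip, `dzeroSignSumHP_nonpos` bounds
`kOnlyStarSum c + mOnlyStarSum (¬c)` by `0`, and the colour flip identifies the two
(`mOnlyStarSum_eq_kOnlyStarSum_not`): **`kOnlyStarSum ≤ 0` for every star**
(`kOnlyStarSum_nonpos`), the `K`-side of REACH-star (`proofs/P3-HDR.md` §7(b)) and the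
localisation of REACH (`M9ReachedSum`) to the co-fibres, `T`-edges allowed.  Own work; std
axioms.
-/

namespace Summit.Ventures.PercRepro2

namespace NoPocket

open Finset Classical RegionHub OneColourSwitch SideSwitch TermSwitch

variable {V : Type*} {E : Type*}

section Defs

variable [Fintype E] [DecidableEq E] {ends : E → Sym2 V} {p q r s d : V}

/-- The edges at `d` carry the colours `c`. -/
def StarEq (ends : E → Sym2 V) (d : V) (c : E → Bool) (ω : Config E) : Prop :=
  ∀ e, d ∈ ends e → ω e = c e

/-- The one-sided `K`-part of the `d`-star co-fibre `c`:
`Σ_{Sep ∧ DOne ∧ d ∈ K₂ ∖ M₂, ω|star = c} σ_pq σ_rs`. -/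
noncomputable def kOnlyStarSum (ends : E → Sym2 V) (p q r s d : V) (c : E → Bool) : ℤ :=
  ∑ ω : Config E, if sep2 ends p q r s ω ∧ DOne ends r s d ω ∧
      (d ∈ K2 ends r s ω ∧ d ∉ M2 ends r s ω) ∧ StarEq ends d c ω then
    sigma ends ω p q * sigma ends ω r s else 0

/-- The one-sided `M`-part of the `d`-star co-fibre `c`. -/
noncomputable def mOnlyStarSum (ends : E → Sym2 V) (p q r s d : V) (c : E → Bool) : ℤ :=
  ∑ ω : Config E, if sep2 ends p q r s ω ∧ DOne ends r s d ω ∧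
      (d ∈ M2 ends r s ω ∧ d ∉ K2 ends r s ω) ∧ StarEq ends d c ω then
    sigma ends ω p q * sigma ends ω r s else 0

/-- The fibre predicate: `K`-only with the star `c`, or `M`-only with the star `¬c`. -/
def KMStar (ends : E → Sym2 V) (r s d : V) (c : E → Bool) (ω : Config E) : Prop :=
  (d ∈ K2 ends r s ω ∧ d ∉ M2 ends r s ω ∧ StarEq ends d c ω) ∨
    (d ∈ M2 ends r s ω ∧ d ∉ K2 ends r s ω ∧ StarEq ends d (fun e => !c e) ω)

end Defs

section Flip

variable [Fintype E] [DecidableEq E] {ends : E → Sym2 V} {p q r s d : V}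

omit [Fintype E] [DecidableEq E] in
/-- `σ` of the complement is `−σ`. -/
lemma sigma_compl_neg (ω : Config E) (a b : V) :
    sigma ends (OneColourSwitch.compl ω) a b = - sigma ends ω a b := by
  unfold sigma
  rw [compl_compl]
  ring

omit [Fintype E] [DecidableEq E] in
/-- The star condition of the complement, with the complementary colours. -/
lemma starEq_compl_iff {c : E → Bool} {ω : Config E} :
    StarEq ends d (fun e => !c e) (OneColourSwitch.compl ω) ↔ StarEq ends d c ω := by
  unfold StarEq
  simp only [OneColourSwitch.compl, Bool.not_inj_iff]

omit [Fintype E] [DecidableEq E] in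
/-- `DOne` of the complement. -/
lemma DOne_compl_iff_star {ω : Config E} :
    DOne ends r s d (OneColourSwitch.compl ω) ↔ DOne ends r s d ω :=
  ⟨fun h => by simpa using DOne_compl h, fun h => DOne_compl h⟩

/-- **The colour flip exchanges the two one-sided parts**: `mOnlyStarSum c = kOnlyStarSum (¬c)`. -/
theorem mOnlyStarSum_eq_kOnlyStarSum_not (c : E → Bool) :
    mOnlyStarSum ends p q r s d c = kOnlyStarSum ends p q r s d (fun e => !c e) := by
  unfold mOnlyStarSum kOnlyStarSum
  refine Fintype.sum_equiv complPerm _ _ (fun ω => ?_)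
  have hperm : complPerm ω = OneColourSwitch.compl ω := rfl
  rw [hperm, sep2_compl, DOne_compl_iff_star, K2_compl, M2_compl, starEq_compl_iff, sigma_compl_neg,
    sigma_compl_neg, neg_mul_neg]

end Flip

section Star

variable [Fintype V] [DecidableEq V] [Fintype E] [DecidableEq E] {ends : E → Sym2 V}
  {p q r s d : V}

omit [Fintype V] [DecidableEq V] [Fintype E] [DecidableEq E] in
/-- An edge at `d` has the form `s(d, y)`. -/
lemma exists_ends_eq_of_mem {e : E} (h : d ∈ ends e) : ∃ y, ends e = s(d, y) := by
  obtain ⟨x, y, hxy⟩ : ∃ x y, ends e = s(x, y) := Sym2.ind (fun x y => ⟨x, y, rfl⟩) (ends e)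
  rw [hxy, Sym2.mem_iff] at h
  rcases h with rfl | rfl
  · exact ⟨y, hxy⟩
  · exact ⟨x, hxy.trans Sym2.eq_swap⟩

omit [Fintype V] [DecidableEq V] [Fintype E] [DecidableEq E] in
/-- An edge at a vertex of `S` touches `S`. -/
lemma mem_touches_of_mem {S : Set V} {e : E} (hd : d ∈ S) (he : d ∈ ends e) :
    e ∈ touches ends S := by
  obtain ⟨y, hy⟩ := exists_ends_eq_of_mem he
  exact ⟨d, hd, y, hy⟩

omit [Fintype E] [DecidableEq E] in
/-- An edge at `d` does not touch a union of components not containing `d`: the other endpoint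
would pull `d` into that component (components are closed inside the sided set). -/
lemma not_mem_touches_unionT_of_notMem {H : Set V} {ρ : Config E} {T : Finset (Finset V)}
    (hT : T ⊆ compsH ends H ρ) (hdA : d ∈ A0H ends H ρ) (hdT : d ∉ unionT T) {e : E}
    (he : d ∈ ends e) : e ∉ touches ends (↑(unionT T) : Set V) := by
  rintro ⟨x, hx, y, hxy⟩
  have hxT : x ∈ unionT T := Finset.mem_coe.1 hx
  rw [hxy, Sym2.mem_iff] at he
  rcases he with rfl | rfl
  · exact hdT hxT
  · -- `x ∈ unionT T` is adjacent to `d ∈ A0H`, so `d` lies in the same component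
    obtain ⟨C, hCT, hxC⟩ := mem_unionT.1 hxT
    have hclosed := closedIn_of_mem_compsH (hT hCT)
    have hdS : d ∈ sidedH ends H ρ := by
      rw [sidedH_eq_coe_A0H]; exact Finset.mem_coe.2 hdA
    have hdC : d ∈ (↑C : Set V) := hclosed e x d hxy (Finset.mem_coe.2 hxC) hdS
    exact hdT (mem_unionT.2 ⟨C, hCT, Finset.mem_coe.1 hdC⟩)

omit [Fintype E] [DecidableEq E] in
/-- **Star constancy on the `Y`-half**: if `d ∉ ⋃T`, the star of `d` in `ρ_T` is the star in
`ρ`. -/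
lemma starEq_assignC_of_notMem_unionT {H : Set V} {ρ : Config E} {T : Finset (Finset V)}
    (hT : T ⊆ compsH ends H ρ) (hdA : d ∈ A0H ends H ρ) (hdT : d ∉ unionT T) (c : E → Bool) :
    StarEq ends d c (assignC ends T ρ) ↔ StarEq ends d c ρ := by
  unfold StarEq
  refine forall_congr' (fun e => forall_congr' (fun he => ?_))
  simp only [assignC, assign]
  rw [flipTouch_of_notMem ends (not_mem_touches_unionT_of_notMem hT hdA hdT he)]

omit [Fintype V] [Fintype E] [DecidableEq E] in
/-- **Star flip on the `W`-half**: if `d ∈ ⋃T`, the star of `d` in `ρ_T` is the complementary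
star. -/
lemma starEq_assignC_of_mem_unionT {ρ : Config E} {T : Finset (Finset V)}
    (hdT : d ∈ unionT T) (c : E → Bool) :
    StarEq ends d (fun e => !c e) (assignC ends T ρ) ↔ StarEq ends d c ρ := by
  unfold StarEq
  refine forall_congr' (fun e => forall_congr' (fun he => ?_))
  simp only [assignC, assign]
  rw [flipTouch_of_mem ends (mem_touches_of_mem (Finset.mem_coe.2 hdT) he)]
  exact Bool.not_inj_iff

omit [Fintype V] [DecidableEq V] [Fintype E] [DecidableEq E] in
/-- The star of `d` is untouched by the outside flip when `d` is not outside. -/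
lemma starEq_flipIn_OsetH_iff {H : Set V} {ρ : Config E} (hdO : d ∉ OsetH ends H ρ)
    (c : E → Bool) :
    StarEq ends d c (flipIn ends (OsetH ends H ρ) ρ) ↔ StarEq ends d c ρ := by
  unfold StarEq
  refine forall_congr' (fun e => forall_congr' (fun he => ?_))
  have hnot : e ∉ within ends (OsetH ends H ρ) := by
    rintro ⟨x, hx, y, hy, hxy⟩
    rw [hxy, Sym2.mem_iff] at he
    rcases he with rfl | rfl
    · exact hdO hx
    · exact hdO hy
  rw [flipIn_of_notMem hnot]

end Star

section Main

variable [Fintype V] [DecidableEq V] [Fintype E] [DecidableEq E] {ends : E → Sym2 V}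
  {p q r s d : V}

omit [Fintype V] [DecidableEq V] [Fintype E] [DecidableEq E] in
/-- A vertex of the outside is in neither world. -/
lemma not_mem_worlds_of_mem_OsetH {H : Set V} {ω : Config E} {x : V}
    (hx : x ∈ OsetH ends H ω) : x ∉ KH ends H ω ∧ x ∉ MH ends H ω := by
  simp only [OsetH, Set.mem_compl_iff, Set.mem_union, not_or] at hx
  exact hx

omit [Fintype V] [DecidableEq V] [Fintype E] [DecidableEq E] in
/-- `K`-only with `Sep ∧ DOne` is `K`-only with `Sep_H ∧ DZero_H`, `H = {r, s}`. -/
lemma kOnly_iff_H (hr : d ≠ r) (hs : d ≠ s) (ω : Config E) :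
    (sep2 ends p q r s ω ∧ DOne ends r s d ω ∧ (d ∈ K2 ends r s ω ∧ d ∉ M2 ends r s ω)) ↔
      (sepH ends p q ({r, s} : Set V) ω ∧ DZeroH ends ({r, s} : Set V) ω ∧
        (d ∈ K2 ends r s ω ∧ d ∉ M2 ends r s ω)) := by
  constructor
  · rintro ⟨hsep, hD, hK, hM⟩
    have h1 := (one_sided_iff (p := p) (q := q) hr hs ω).1 ⟨hsep, hD, Or.inl hK, fun h => hM h.2⟩
    have h2 := (reached_dzero_iff_pair (p := p) (q := q) (d := d) ω).1 h1
    exact ⟨h2.1, h2.2.1, hK, hM⟩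
  · rintro ⟨hsep, hD, hK, hM⟩
    have hO : d ∉ OsetH ends ({r, s} : Set V) ω := fun h =>
      (not_mem_worlds_of_mem_OsetH h).1 hK
    have h1 := (reached_dzero_iff_pair (p := p) (q := q) (d := d) ω).2 ⟨hsep, hD, hO⟩
    have h2 := (one_sided_iff (p := p) (q := q) hr hs ω).2 h1
    exact ⟨h2.1, h2.2.1, hK, hM⟩

omit [Fintype V] [DecidableEq V] [Fintype E] [DecidableEq E] in
/-- `M`-only with `Sep ∧ DOne` is `M`-only with `Sep_H ∧ DZero_H`, `H = {r, s}`. -/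
lemma mOnly_iff_H (hr : d ≠ r) (hs : d ≠ s) (ω : Config E) :
    (sep2 ends p q r s ω ∧ DOne ends r s d ω ∧ (d ∈ M2 ends r s ω ∧ d ∉ K2 ends r s ω)) ↔
      (sepH ends p q ({r, s} : Set V) ω ∧ DZeroH ends ({r, s} : Set V) ω ∧
        (d ∈ M2 ends r s ω ∧ d ∉ K2 ends r s ω)) := by
  constructor
  · rintro ⟨hsep, hD, hM, hK⟩
    have h1 := (one_sided_iff (p := p) (q := q) hr hs ω).1 ⟨hsep, hD, Or.inr hM, fun h => hK h.1⟩
    have h2 := (reached_dzero_iff_pair (p := p) (q := q) (d := d) ω).1 h1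
    exact ⟨h2.1, h2.2.1, hM, hK⟩
  · rintro ⟨hsep, hD, hM, hK⟩
    have hO : d ∉ OsetH ends ({r, s} : Set V) ω := fun h =>
      (not_mem_worlds_of_mem_OsetH h).2 hM
    have h1 := (reached_dzero_iff_pair (p := p) (q := q) (d := d) ω).2 ⟨hsep, hD, hO⟩
    have h2 := (one_sided_iff (p := p) (q := q) hr hs ω).2 h1
    exact ⟨h2.1, h2.2.1, hM, hK⟩

omit [Fintype V] [DecidableEq V] in
/-- **The two one-sided parts are the restricted terminal sum** for the predicate `KMStar`. -/
theorem kOnly_add_mOnly_eq_dzeroSignSumHP (hr : d ≠ r) (hs : d ≠ s) (c : E → Bool) :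
    kOnlyStarSum ends p q r s d c + mOnlyStarSum ends p q r s d (fun e => !c e) =
      dzeroSignSumHP ends p q r s ({r, s} : Set V) (KMStar ends r s d c) := by
  unfold kOnlyStarSum mOnlyStarSum dzeroSignSumHP
  rw [← Finset.sum_add_distrib]
  refine Finset.sum_congr rfl (fun ω _ => ?_)
  by_cases hK : sep2 ends p q r s ω ∧ DOne ends r s d ω ∧
      (d ∈ K2 ends r s ω ∧ d ∉ M2 ends r s ω) ∧ StarEq ends d c ω
  · have hK' := (kOnly_iff_H (p := p) (q := q) hr hs ω).1 ⟨hK.1, hK.2.1, hK.2.2.1⟩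
    rw [if_pos hK, if_neg (fun h => h.2.2.1.2 hK.2.2.1.1),
      if_pos ⟨hK'.1, hK'.2.1, Or.inl ⟨hK.2.2.1.1, hK.2.2.1.2, hK.2.2.2⟩⟩, add_zero]
  · rw [if_neg hK, zero_add]
    by_cases hM : sep2 ends p q r s ω ∧ DOne ends r s d ω ∧
        (d ∈ M2 ends r s ω ∧ d ∉ K2 ends r s ω) ∧ StarEq ends d (fun e => !c e) ω
    · have hM' := (mOnly_iff_H (p := p) (q := q) hr hs ω).1 ⟨hM.1, hM.2.1, hM.2.2.1⟩
      rw [if_pos hM, if_pos ⟨hM'.1, hM'.2.1, Or.inr ⟨hM.2.2.1.1, hM.2.2.1.2, hM.2.2.2⟩⟩]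
    · rw [if_neg hM, if_neg]
      rintro ⟨hsep, hD, hKM⟩
      rcases hKM with ⟨h1, h2, h3⟩ | ⟨h1, h2, h3⟩
      · exact hK ⟨((kOnly_iff_H (p := p) (q := q) hr hs ω).2 ⟨hsep, hD, h1, h2⟩).1,
          ((kOnly_iff_H (p := p) (q := q) hr hs ω).2 ⟨hsep, hD, h1, h2⟩).2.1, ⟨h1, h2⟩, h3⟩
      · exact hM ⟨((mOnly_iff_H (p := p) (q := q) hr hs ω).2 ⟨hsep, hD, h1, h2⟩).1,
          ((mOnly_iff_H (p := p) (q := q) hr hs ω).2 ⟨hsep, hD, h1, h2⟩).2.1, ⟨h1, h2⟩, h3⟩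

/-- **Fibre invariance of `KMStar`**: along the component assignments of a representative. -/
theorem KMStar_assignC_iff (hr : d ≠ r) (hs : d ≠ s) (c : E → Bool) {ρ : Config E}
    (hρ : ρ ∈ RepH ends p q ({r, s} : Set V)) {T : Finset (Finset V)}
    (hT : T ⊆ compsH ends ({r, s} : Set V) ρ) :
    KMStar ends r s d c (assignC ends T ρ) ↔ KMStar ends r s d c ρ := by
  have hdH : d ∉ ({r, s} : Set V) := by
    simp only [Set.mem_insert_iff, Set.mem_singleton_iff, not_or]
    exact ⟨hr, hs⟩
  by_cases hdA : d ∈ A0H ends ({r, s} : Set V) ρ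
  · -- `d` is sided in `ρ`: `K`-only in `ρ` (every block is on the `Y`-side)
    have hdK : d ∈ KH ends ({r, s} : Set V) ρ := A0H_subset_KH_of_mem_RepH hρ hdA
    have hdM : d ∉ MH ends ({r, s} : Set V) ρ := fun h => hdH ((mem_RepH.1 hρ).2 d h)
    have hρside : KMStar ends r s d c ρ ↔ StarEq ends d c ρ := by
      unfold KMStar
      constructor
      · rintro (⟨_, _, h⟩ | ⟨h1, _, _⟩)
        · exact h
        · exact absurd h1 hdM
      · intro h
        exact Or.inl ⟨hdK, hdM, h⟩
    rw [hρside]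
    by_cases hdT : d ∈ unionT T
    · -- the `W`-half: `d` is `M`-only with the complementary star
      obtain ⟨hK', hM'⟩ := sideC_of_mem_H hρ hT hdT
      unfold KMStar
      rw [starEq_assignC_of_mem_unionT hdT c]
      constructor
      · rintro (⟨h1, _, _⟩ | ⟨_, _, h⟩)
        · exact absurd h1 hK'
        · exact h
      · intro h
        exact Or.inr ⟨hM', hK', h⟩
    · -- the `Y`-half: `d` is `K`-only with the same star
      have hdU : d ∈ unionT (compsH ends ({r, s} : Set V) ρ) \ unionT T := by
        rw [unionT_compsH]
        exact Finset.mem_sdiff.2 ⟨hdA, hdT⟩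
      obtain ⟨hK', hM'⟩ := sideC_of_mem_sdiff_H hρ hT (Finset.Subset.refl _) hdU
      unfold KMStar
      rw [starEq_assignC_of_notMem_unionT hT hdA hdT c]
      constructor
      · rintro (⟨_, _, h⟩ | ⟨h1, _, _⟩)
        · exact h
        · exact absurd h1 hM'
      · intro h
        exact Or.inl ⟨hK', hM', h⟩
  · -- `d` is outside: unreached in every point of the fibre
    have hdO : d ∈ OsetH ends ({r, s} : Set V) ρ := by
      by_contra hO
      apply hdA
      rw [mem_A0H]
      refine ⟨?_, hdH⟩
      simp only [OsetH, Set.mem_compl_iff, not_not] at hO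
      exact hO
    have hdO' : d ∈ OsetH ends ({r, s} : Set V) (assignC ends T ρ) := by
      rw [OsetH_assignC hT]; exact hdO
    obtain ⟨hK1, hM1⟩ := not_mem_worlds_of_mem_OsetH hdO
    obtain ⟨hK2, hM2⟩ := not_mem_worlds_of_mem_OsetH hdO'
    unfold KMStar
    constructor
    · rintro (⟨h, _, _⟩ | ⟨h, _, _⟩)
      · exact absurd h hK2
      · exact absurd h hM2
    · rintro (⟨h, _, _⟩ | ⟨h, _, _⟩)
      · exact absurd h hK1
      · exact absurd h hM1

omit [Fintype V] [DecidableEq V] [Fintype E] [DecidableEq E] in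
/-- **Invariance of `KMStar` under the outside flip.** -/
theorem KMStar_flipOH_iff (c : E → Bool) {ρ : Config E} :
    KMStar ends r s d c (flipOH ends ({r, s} : Set V) ρ) ↔ KMStar ends r s d c ρ := by
  have hK : K2 ends r s (flipOH ends ({r, s} : Set V) ρ) = K2 ends r s ρ :=
    KH_flipIn_OsetH ({r, s} : Set V) ρ
  have hM : M2 ends r s (flipOH ends ({r, s} : Set V) ρ) = M2 ends r s ρ :=
    MH_flipIn_OsetH ({r, s} : Set V) ρ
  by_cases hdO : d ∈ OsetH ends ({r, s} : Set V) ρ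
  · obtain ⟨hK1, hM1⟩ := not_mem_worlds_of_mem_OsetH hdO
    unfold KMStar
    rw [hK, hM]
    constructor
    · rintro (⟨h, _, _⟩ | ⟨h, _, _⟩)
      · exact absurd h hK1
      · exact absurd h hM1
    · rintro (⟨h, _, _⟩ | ⟨h, _, _⟩)
      · exact absurd h hK1
      · exact absurd h hM1
  · unfold KMStar
    show (d ∈ K2 ends r s (flipIn ends (OsetH ends ({r, s} : Set V) ρ) ρ) ∧
        d ∉ M2 ends r s (flipIn ends (OsetH ends ({r, s} : Set V) ρ) ρ) ∧
        StarEq ends d c (flipIn ends (OsetH ends ({r, s} : Set V) ρ) ρ)) ∨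
      (d ∈ M2 ends r s (flipIn ends (OsetH ends ({r, s} : Set V) ρ) ρ) ∧
        d ∉ K2 ends r s (flipIn ends (OsetH ends ({r, s} : Set V) ρ) ρ) ∧
        StarEq ends d (fun e => !c e) (flipIn ends (OsetH ends ({r, s} : Set V) ρ) ρ)) ↔ _
    rw [starEq_flipIn_OsetH_iff hdO c, starEq_flipIn_OsetH_iff hdO (fun e => !c e)]
    have hK' : K2 ends r s (flipIn ends (OsetH ends ({r, s} : Set V) ρ) ρ) = K2 ends r s ρ :=
      KH_flipIn_OsetH ({r, s} : Set V) ρ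
    have hM' : M2 ends r s (flipIn ends (OsetH ends ({r, s} : Set V) ρ) ρ) = M2 ends r s ρ :=
      MH_flipIn_OsetH ({r, s} : Set V) ρ
    rw [hK', hM']

/-- **The one-sided `K`-part of every `d`-star co-fibre is non-positive**:
`Σ_{Sep ∧ DOne ∧ d ∈ K₂ ∖ M₂, ω|star = c} σ_pq σ_rs ≤ 0` for every colouring `c` of the edges
at `d` (`d ≠ r, s`; `T`-edges allowed). -/
theorem kOnlyStarSum_nonpos (hr : d ≠ r) (hs : d ≠ s) (c : E → Bool) :
    kOnlyStarSum ends p q r s d c ≤ 0 := by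
  have hsum := kOnly_add_mOnly_eq_dzeroSignSumHP (ends := ends) (p := p) (q := q) hr hs c
  have hm : mOnlyStarSum ends p q r s d (fun e => !c e) = kOnlyStarSum ends p q r s d c := by
    rw [mOnlyStarSum_eq_kOnlyStarSum_not]
    simp only [Bool.not_not]
  have hrH : r ∈ ({r, s} : Set V) := by simp
  have hle := dzeroSignSumHP_nonpos (ends := ends) p q s hrH (KMStar ends r s d c)
    (fun ρ hρ T hT => KMStar_assignC_iff (p := p) (q := q) hr hs c hρ hT)
    (fun ρ _ => KMStar_flipOH_iff c)
  rw [hm] at hsum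
  linarith

/-- The mirror: the one-sided `M`-part of every co-fibre is non-positive. -/
theorem mOnlyStarSum_nonpos (hr : d ≠ r) (hs : d ≠ s) (c : E → Bool) :
    mOnlyStarSum ends p q r s d c ≤ 0 := by
  rw [mOnlyStarSum_eq_kOnlyStarSum_not]
  exact kOnlyStarSum_nonpos hr hs _

end Main

end NoPocket

end Summit.Ventures.PercRepro2
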